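import Literature.AlgebraicGeometry.ShimuraVarieties.RapoportSmithlingZhang2020.AppASignInvariants
import HarnessLib

/-!
# [RapoportSmithlingZhang2020, App. A Remark A.2] the sign bookkeeping `Φ ↦ Φ̄` — DISCHARGED: `RSZ2020_A_2_sgn_conj_holds`

Kernel-lane companion of the statement carpet ★ `Literature/AlgebraicGeometry/ShimuraVarieties/RapoportSmithlingZhang2020/
AppASignInvariants.lean`: the named fact ★ `RSZ2020_A_2_sgn_conj` — for a generalized CM type `r` of rank `n`
(`r_φ + r_φ̄ = n` for every `φ : F → ℂ`) and a finite set `Φ_v` of complex embeddings, the two signs `(-1)^{Σ_{Φ_v} r_φ}` and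
`(-1)^{Σ_{Φ_v} r_φ̄}` differ by the constant `(-1)^{n·|Φ_v|}` («working with respect to the canonical function … is tantamount to
replacing `Φ` by `Φ̄` … the statement and proof of Proposition A.1 for this version go through virtually without change», held text
`paper:arxiv-1710.06962` p0043 L33) — now has its `_holds` theorem: `Σ_{Φ_v} r_φ + Σ_{Φ_v} r_φ̄ = Σ_{Φ_v} n = n·|Φ_v|`.

No new definitions, no new named facts (D-0026).
-/

namespace Literature.AlgebraicGeometry.ShimuraVarieties.RapoportSmithlingZhang2020.AppASignInvariants

open _root_.NumberField

variable (F : Type) [Field F]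

/-- **[RSZ2020, App. A Remark A.2] — DISCHARGED**: `sgn(Φ_v, r) · sgn(Φ_v, r ∘ conj) = (-1)^{n |Φ_v|}` for a generalized CM type `r`
of rank `n` (`r_φ + r_φ̄ = n`). [cite: RapoportSmithlingZhang2020Diagonal, App. A Remark A.2 p. 58] -/
theorem RSZ2020_A_2_sgn_conj_holds : RSZ2020_A_2_sgn_conj F := by
  intro n r hr Φv
  calc sgn Φv r * sgn Φv (fun φ => r (ComplexEmbedding.conjugate φ))
      = (-1 : ℤˣ) ^ ((∑ φ ∈ Φv, r φ) + ∑ φ ∈ Φv, r (ComplexEmbedding.conjugate φ)) := (pow_add _ _ _).symm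
    _ = (-1 : ℤˣ) ^ (n * Φv.card) := by
      rw [← Finset.sum_add_distrib, Finset.sum_congr rfl fun φ _ => hr φ, Finset.sum_const, smul_eq_mul, mul_comm]

end Literature.AlgebraicGeometry.ShimuraVarieties.RapoportSmithlingZhang2020.AppASignInvariants
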